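import Mathlib.NumberTheory.ZetaValues
import Mathlib.NumberTheory.LSeries.DirichletContinuation
import Mathlib.NumberTheory.LSeries.Nonvanishing
import Mathlib.NumberTheory.DirichletCharacter.GaussSum
import Mathlib.NumberTheory.LegendreSymbol.AddCharacter
import Mathlib.Analysis.SpecialFunctions.Complex.CircleAddChar
import Literature.NumberTheory.LFunctions.GeneralizedBernoulliNumbers
import HarnessLib

/-!
# Dirichlet `L`-values at positive integers of the right parity:
# `L(k, ψ) = -(2πi)^k B_{k,ψ̄} / (2 · k! · N^{k-1} · W(ψ̄))`, and `W(ψ) W(ψ̄) = ψ(-1) N`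

Topic `Literature/NumberTheory/LFunctions`; namespace `Literature.NumberTheory.LFunctions`.
THEOREMS ONLY (no definition, no named fact).

For a PRIMITIVE Dirichlet character `ψ` modulo `N ≥ 1` with Gauss sum
`W(ψ) = ∑_{a mod N} ψ(a) e^{2πia/N}` (Mathlib `gaussSum ψ ZMod.stdAddChar`):

* `isPrimitive_inv` — `ψ̄ = ψ⁻¹` is primitive (Mathlib `conductor_inv`);
* `sum_inv_apply_mul_cexp` — **Gauss inversion** `∑_a ψ̄(a) e^{2πina/N} = ψ(n) W(ψ̄)` for every
  `n ∈ ℤ` (Mathlib `gaussSum_mulShift_of_isPrimitive`);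
* `gaussSum_mul_gaussSum_inv` — **`W(ψ) W(ψ̄) = ψ(-1) N`** (so `W(ψ) ≠ 0`,
  `gaussSum_ne_zero`): `W(ψ)W(ψ̄) = ∑_b e^{2πib/N} ψ̄(b) W(ψ) = ∑_a ψ(a) ∑_b e^{2πib(a+1)/N}` and
  orthogonality of the additive characters (Mathlib `AddChar.sum_mulShift`,
  `ZMod.isPrimitive_stdAddChar`).  (Mathlib's `gaussSum_mul_gaussSum_eq_card` is the finite-FIELD
  case only; here `N` is any modulus.)  Apostol, Thm. 8.11 / Thm. 8.15 (c): `|G(1,χ)|² = k` for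
  primitive `χ`, with the same proof.
* `two_mul_gaussSum_mul_LFunction_eq` — for `ψ(-1) = (-1)^k` and `k ≥ 2`:
  **`2 W(ψ̄) L(k, ψ) = -((2πi)^k / k!) · B_{k,ψ̄} / N^{k-1}`**, with `B_{k,ψ̄}` the generalized
  Bernoulli number of `GeneralizedBernoulliNumbers` (`B_{k,χ} = N^{k-1} ∑_c χ(c) B_k(c/N)`).
  Proof: Mathlib's Fourier expansion of the Bernoulli polynomials
  `∑_{n ≥ 1} (e^{2πinx} + (-1)^k e^{-2πinx})/n^k = -(2πi)^k B_k(x)/k!` on `[0, 1]`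
  (`hasSum_one_div_nat_pow_mul_fourier`) at `x = a/N`, summed against `ψ̄(a)`, and Gauss
  inversion.  For `ψ = 𝟙` modulo `1` this is Euler's `ζ(k) = -(2πi)^k B_k/(2 · k!)`.
  Hence `LFunction_eq_bernoulli` — `L(k, ψ) = -(2πi)^k B_{k,ψ̄}/(2 · k! · N^{k-1} · W(ψ̄))` — and
  `generalizedBernoulli_inv_ne_zero` — `B_{k,ψ̄} ≠ 0` (from `L(k, ψ) ≠ 0`).
  Sources: Apostol, Thm. 12.19 (the Fourier expansion `B_n(x) = -n!/(2πi)^n ∑_{k ≠ 0} e^{2πikx}/k^n`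
  on `[0,1]`, `n ≥ 2`) and Thm. 8.15 (b) (separability `G(n, χ̄) = χ(n) G(1, χ̄)` for primitive
  `χ`); cf. Washington, Thm. 4.2 (`L(1-n,χ) = -B_{n,χ}/n`) with the functional equation.
* `eisenstein_normalising_const` — `2 ((-2πi)^k/(k-1)!) W(ψ)/(N^k L(k,ψ)) = -4k/B_{k,ψ̄}`.

The last identity is the constant of the Eisenstein series with nebentypus
(`EisensteinSeriesNebentypusQExpansion`:
`E_k^{ψ̄} = 2 + (2 C_k W(ψ)/(N^k L(k,ψ))) ∑ σ_{k-1}^{ψ̄}(n) qⁿ`), i.e.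
`E_k^{ψ̄} = -(4k/B_{k,ψ̄}) · (-B_{k,ψ̄}/2k + ∑ σ_{k-1}^{ψ̄}(n) qⁿ)` — Billerey–Menares (7.1.3).

## References

* T. M. Apostol, *Introduction to Analytic Number Theory*, UTM, Springer (1976), Thm. 8.11,
  Thm. 8.15, Thm. 12.19. [Apostol1976]
* L. C. Washington, *Introduction to Cyclotomic Fields*, 2nd ed., GTM 83 (1997), Thm. 4.2.
  [Washington1997]
* F. Diamond, J. Shurman, *A First Course in Modular Forms*, GTM 228 (2005), §4.7.
  [DiamondShurman2005]
* N. Billerey, R. Menares, *Strong modularity of reducible Galois representations*, Trans. AMS 370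
  (2018), §1.1 (`W(φ)`), §1.3 ((7.1.13)). [BillereyMenares2018]
-/

noncomputable section

open Finset Complex

namespace Literature.NumberTheory.LFunctions

variable {N : ℕ} [NeZero N] (ψ : DirichletCharacter ℂ N)

/-! ### Primitivity of `ψ̄` and Gauss inversion -/

omit [NeZero N] in
/-- The inverse of a primitive character is primitive (same conductor). [folklore] -/
theorem isPrimitive_inv (hψ : ψ.IsPrimitive) : ψ⁻¹.IsPrimitive := by
  rw [DirichletCharacter.isPrimitive_def, DirichletCharacter.conductor_inv]
  exact hψ

/-- **Gauss inversion**: for a primitive `ψ` and every `n ∈ ℤ`,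
`∑_{a mod N} ψ̄(a) e^{2πi n ã/N} = ψ(n) W(ψ̄)`, `W(ψ̄) = gaussSum ψ⁻¹ stdAddChar` (separability of
the Gauss sums of a primitive character). [cite: Apostol1976, Thm. 8.15 (b)] -/
theorem sum_inv_apply_mul_cexp (hψ : ψ.IsPrimitive) (n : ℤ) :
    ∑ a : ZMod N, ψ⁻¹ a * cexp (2 * Real.pi * I * n * a.val / N) =
      ψ n * gaussSum ψ⁻¹ (ZMod.stdAddChar (N := N)) := by
  have h := gaussSum_mulShift_of_isPrimitive (ZMod.stdAddChar (N := N)) (isPrimitive_inv ψ hψ)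
    (n : ZMod N)
  rw [inv_inv] at h
  rw [← h, gaussSum]
  refine Finset.sum_congr rfl fun a _ ↦ ?_
  congr 1
  rw [AddChar.mulShift_apply]
  have ha : ((n : ZMod N)) * a = (((n * (a.val : ℤ) : ℤ)) : ZMod N) := by
    push_cast
    simp
  rw [ha, ZMod.stdAddChar_coe]
  congr 1
  push_cast
  ring

/-! ### `W(ψ) W(ψ̄) = ψ(-1) N` -/

/-- Orthogonality: `∑_{b mod N} e^{2πi b m/N} = N` if `m = 0` and `0` otherwise.
[folklore] -/
theorem sum_stdAddChar_mul (m : ZMod N) :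
    ∑ b : ZMod N, ZMod.stdAddChar (b * m) = if m = 0 then (N : ℂ) else 0 := by
  classical
  rw [AddChar.sum_mulShift m (ZMod.isPrimitive_stdAddChar N), ZMod.card, Nat.cast_ite, Nat.cast_zero]

/-- **`W(ψ) W(ψ̄) = ψ(-1) N` for a primitive character modulo `N`** (any `N ≥ 1`; Mathlib's
`gaussSum_mul_gaussSum_eq_card` covers prime `N`; Apostol's `|G(1,χ)|² = k`, Thm. 8.11 /
8.15 (c), with `W(ψ̄) = ψ(-1) conj W(ψ)`). [cite: Apostol1976, Thm. 8.11 and Thm. 8.15 (c)] -/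
theorem gaussSum_mul_gaussSum_inv (hψ : ψ.IsPrimitive) :
    gaussSum ψ (ZMod.stdAddChar (N := N)) * gaussSum ψ⁻¹ (ZMod.stdAddChar (N := N)) =
      ψ (-1) * N := by
  classical
  calc gaussSum ψ (ZMod.stdAddChar (N := N)) * gaussSum ψ⁻¹ (ZMod.stdAddChar (N := N))
      = ∑ b : ZMod N, ZMod.stdAddChar b * (ψ⁻¹ b * gaussSum ψ (ZMod.stdAddChar (N := N))) := by
        rw [mul_comm, gaussSum, Finset.sum_mul]
        refine Finset.sum_congr rfl fun b _ ↦ ?_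
        ring
    _ = ∑ b : ZMod N, ZMod.stdAddChar b *
          ∑ a : ZMod N, ψ a * ZMod.stdAddChar (b * a) := by
        refine Finset.sum_congr rfl fun b _ ↦ ?_
        rw [← gaussSum_mulShift_of_isPrimitive _ hψ b, gaussSum]
        simp only [AddChar.mulShift_apply]
    _ = ∑ a : ZMod N, ψ a * ∑ b : ZMod N, ZMod.stdAddChar (b * (a + 1)) := by
        simp only [Finset.mul_sum]
        rw [Finset.sum_comm]
        refine Finset.sum_congr rfl fun a _ ↦ Finset.sum_congr rfl fun b _ ↦ ?_
        rw [mul_add, mul_one, AddChar.map_add_eq_mul]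
        ring
    _ = ψ (-1) * N := by
        simp_rw [sum_stdAddChar_mul, add_eq_zero_iff_eq_neg, mul_ite, mul_zero]
        rw [Finset.sum_ite_eq' Finset.univ (-1 : ZMod N)]
        simp

/-- The Gauss sum of a primitive character is non-zero. [folklore] -/
theorem gaussSum_ne_zero (hψ : ψ.IsPrimitive) :
    gaussSum ψ (ZMod.stdAddChar (N := N)) ≠ 0 := by
  intro h
  have := gaussSum_mul_gaussSum_inv ψ hψ
  rw [h, zero_mul] at this
  have hN : (N : ℂ) ≠ 0 := by exact_mod_cast NeZero.ne N
  have h1 : ψ (-1) ≠ 0 := by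
    have hu : IsUnit (-1 : ZMod N) := isUnit_one.neg
    exact (hu.map ψ).ne_zero
  exact mul_ne_zero h1 hN this.symm

/-! ### `L(k, ψ)` in terms of `B_{k,ψ̄}` -/

omit [NeZero N] in
/-- The real Bernoulli function of Mathlib's `ZetaValues`, cast to `ℂ`, is the Bernoulli
polynomial evaluated in `ℂ`. [folklore] -/
theorem ofReal_bernoulliFun (k : ℕ) (x : ℝ) :
    ((bernoulliFun k x : ℝ) : ℂ) = ((Polynomial.bernoulli k).map (algebraMap ℚ ℂ)).eval (x : ℂ) := by
  have h1 : ((bernoulliFun k x : ℝ) : ℂ) =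
      Complex.ofRealHom ((Polynomial.bernoulli k).eval₂ (algebraMap ℚ ℝ) x) := by
    rw [bernoulliFun, Polynomial.eval_map]
    rfl
  rw [h1, Polynomial.hom_eval₂, Polynomial.eval_map]
  congr 1

/-- **`2 W(ψ̄) L(k, ψ) = -((2πi)^k/k!) B_{k,ψ̄} / N^{k-1}`** for a primitive `ψ` modulo `N` with
`ψ(-1) = (-1)^k`, `k ≥ 2` (Fourier expansion of the Bernoulli polynomials on `[0,1]`, Mathlib
`hasSum_one_div_nat_pow_mul_fourier` = Apostol Thm. 12.19, at the points `a/N`, summed against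
`ψ̄(a)`, and Gauss inversion `sum_inv_apply_mul_cexp` = Apostol Thm. 8.15 (b)).
[cite: Apostol1976, Thm. 12.19 with Thm. 8.15 (b)] -/
theorem two_mul_gaussSum_mul_LFunction_eq (hψ : ψ.IsPrimitive) {k : ℕ} (hk : 2 ≤ k)
    (hpar : ψ (-1) = (-1) ^ k) :
    2 * gaussSum ψ⁻¹ (ZMod.stdAddChar (N := N)) * ψ.LFunction k =
      -(2 * Real.pi * I) ^ k / k.factorial * generalizedBernoulli k ψ⁻¹ / (N : ℂ) ^ (k - 1) := by
  set W : ℂ := gaussSum ψ⁻¹ (ZMod.stdAddChar (N := N)) with hW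
  have hN : (N : ℂ) ≠ 0 := by exact_mod_cast NeZero.ne N
  -- the Fourier–Bernoulli identity at `x = ã/N`, weighted by `ψ̄(a)` and summed over `a`
  have hx : ∀ a : ZMod N, ((a.val : ℝ) / N) ∈ Set.Icc (0 : ℝ) 1 := fun a ↦
    ⟨by positivity, div_le_one_of_le₀ (by exact_mod_cast a.val_lt.le) (by positivity)⟩
  have hF := hasSum_sum fun (a : ZMod N) (_ : a ∈ Finset.univ) ↦
    (hasSum_one_div_nat_pow_mul_fourier hk (hx a)).mul_left (ψ⁻¹ a)
  -- the `n`-th term is `2 W ψ(n) / n^k`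
  have hterm : ∀ n : ℕ, ∑ a ∈ (Finset.univ : Finset (ZMod N)), ψ⁻¹ a *
      (1 / (n : ℂ) ^ k * (fourier n (((a.val : ℝ) / N : ℝ) : UnitAddCircle) +
        (-1 : ℂ) ^ k * fourier (-n) (((a.val : ℝ) / N : ℝ) : UnitAddCircle))) =
      2 * W * (ψ n / (n : ℂ) ^ k) := by
    intro n
    have h1 : ∀ a : ZMod N, fourier n (((a.val : ℝ) / N : ℝ) : UnitAddCircle) =
        cexp (2 * Real.pi * I * (n : ℤ) * a.val / N) := fun a ↦ by
      rw [fourier_coe_apply]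
      congr 1
      push_cast
      ring
    have h2 : ∀ a : ZMod N, fourier (-n) (((a.val : ℝ) / N : ℝ) : UnitAddCircle) =
        cexp (2 * Real.pi * I * (-n : ℤ) * a.val / N) := fun a ↦ by
      rw [fourier_coe_apply]
      congr 1
      push_cast
      ring
    simp_rw [h1, h2]
    calc ∑ a : ZMod N, ψ⁻¹ a * (1 / (n : ℂ) ^ k * (cexp (2 * Real.pi * I * (n : ℤ) * a.val / N) +
          (-1 : ℂ) ^ k * cexp (2 * Real.pi * I * (-n : ℤ) * a.val / N)))
        = 1 / (n : ℂ) ^ k * ((∑ a : ZMod N, ψ⁻¹ a * cexp (2 * Real.pi * I * (n : ℤ) * a.val / N)) +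
          (-1 : ℂ) ^ k * ∑ a : ZMod N, ψ⁻¹ a * cexp (2 * Real.pi * I * (-n : ℤ) * a.val / N)) := by
          simp only [mul_add, Finset.mul_sum, ← Finset.sum_add_distrib]
          refine Finset.sum_congr rfl fun a _ ↦ ?_
          ring
      _ = 1 / (n : ℂ) ^ k * (ψ n * W + (-1 : ℂ) ^ k * (ψ (-n : ℤ) * W)) := by
          rw [sum_inv_apply_mul_cexp ψ hψ, sum_inv_apply_mul_cexp ψ hψ]
          push_cast
          rfl
      _ = 2 * W * (ψ n / (n : ℂ) ^ k) := by
          have : ψ ((-n : ℤ) : ZMod N) = (-1) ^ k * ψ n := by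
            rw [Int.cast_neg, Int.cast_natCast, ← neg_one_mul, map_mul, hpar]
          rw [this]
          have h11 : ((-1 : ℂ) ^ k) * (-1 : ℂ) ^ k = 1 := by
            rw [← pow_add, ← two_mul, pow_mul, neg_one_sq, one_pow]
          linear_combination (ψ ↑n * W / (n : ℂ) ^ k) * h11
  simp_rw [hterm] at hF
  -- the `L`-series
  have hre : 1 < ((k : ℂ)).re := by simp; omega
  have hL : HasSum (fun n : ℕ ↦ ψ n / (n : ℂ) ^ k) (ψ.LFunction k) := by
    rw [DirichletCharacter.LFunction_eq_LSeries ψ hre]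
    refine ((DirichletCharacter.LSeriesSummable_of_one_lt_re ψ hre).hasSum).congr_fun ?_
    intro n
    rcases eq_or_ne n 0 with rfl | hn
    · simp [zero_pow (show k ≠ 0 by omega)]
    · rw [LSeries.term_of_ne_zero hn, Complex.cpow_natCast]
  have h := hF.unique (hL.mul_left (2 * W))
  -- the right-hand side
  rw [← h, generalizedBernoulli_eq_sum]
  simp_rw [algebraMap_genBernoulliCoeff (show 1 ≤ k by omega), ofReal_bernoulliFun]
  push_cast
  rw [Finset.mul_sum, Finset.sum_div]
  refine Finset.sum_congr rfl fun a _ ↦ ?_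
  have hNk : (N : ℂ) ^ (k - 1) ≠ 0 := pow_ne_zero _ hN
  field_simp

/-- `L(k, ψ) ≠ 0` for an integer `k ≥ 2`. [folklore] -/
theorem LFunction_natCast_ne_zero {k : ℕ} (hk : 2 ≤ k) : ψ.LFunction k ≠ 0 :=
  DirichletCharacter.LFunction_ne_zero_of_one_le_re ψ
    (Or.inr (by exact_mod_cast (show k ≠ 1 by omega))) (by simp; omega)

/-- **`B_{k,ψ̄} ≠ 0`** for a primitive `ψ` with `ψ(-1) = (-1)^k`, `k ≥ 2` (from `L(k, ψ) ≠ 0` and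
`W(ψ̄) ≠ 0`). [cite: Apostol1976, Thm. 12.19 with Thm. 8.15] -/
theorem generalizedBernoulli_inv_ne_zero (hψ : ψ.IsPrimitive) {k : ℕ} (hk : 2 ≤ k)
    (hpar : ψ (-1) = (-1) ^ k) : generalizedBernoulli k ψ⁻¹ ≠ 0 := by
  intro hB
  have h := two_mul_gaussSum_mul_LFunction_eq ψ hψ hk hpar
  rw [hB, mul_zero, zero_div] at h
  exact mul_ne_zero (mul_ne_zero two_ne_zero (gaussSum_ne_zero ψ⁻¹ (isPrimitive_inv ψ hψ)))
    (LFunction_natCast_ne_zero ψ hk) h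

/-- **`L(k, ψ) = -(2πi)^k B_{k,ψ̄} / (2 · k! · N^{k-1} · W(ψ̄))`** (primitive `ψ`,
`ψ(-1) = (-1)^k`, `k ≥ 2`). [cite: Apostol1976, Thm. 12.19 with Thm. 8.15] -/
theorem LFunction_eq_bernoulli (hψ : ψ.IsPrimitive) {k : ℕ} (hk : 2 ≤ k)
    (hpar : ψ (-1) = (-1) ^ k) :
    ψ.LFunction k = -(2 * Real.pi * I) ^ k * generalizedBernoulli k ψ⁻¹ /
      (2 * k.factorial * (N : ℂ) ^ (k - 1) * gaussSum ψ⁻¹ (ZMod.stdAddChar (N := N))) := by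
  have h := two_mul_gaussSum_mul_LFunction_eq ψ hψ hk hpar
  have hW := gaussSum_ne_zero ψ⁻¹ (isPrimitive_inv ψ hψ)
  have hN : (N : ℂ) ^ (k - 1) ≠ 0 := pow_ne_zero _ (by exact_mod_cast NeZero.ne N)
  have hf : (k.factorial : ℂ) ≠ 0 := by exact_mod_cast Nat.factorial_ne_zero k
  rw [eq_div_iff (by simp [hW, hN, hf])]
  have h2 : 2 * gaussSum ψ⁻¹ (ZMod.stdAddChar (N := N)) * ψ.LFunction k *
      ((k.factorial : ℂ) * (N : ℂ) ^ (k - 1)) =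
      -(2 * Real.pi * I) ^ k * generalizedBernoulli k ψ⁻¹ := by
    rw [h]
    field_simp
  linear_combination h2

/-- **The Eisenstein normalising constant**: for a primitive `ψ` with `ψ(-1) = (-1)^k`, `k ≥ 2`,
`2 · ((-2πi)^k/(k-1)!) · W(ψ) / (N^k L(k, ψ)) = -4k / B_{k,ψ̄}` — the ratio between
`E_k^{ψ̄} = ∑_u ψ(u) E_{k,(0,u)} = 2 + (2 C_k W(ψ)/(N^k L(k,ψ))) ∑ σ_{k-1}^{ψ̄}(n) qⁿ` and the
normalised `E_k^{𝟙,ψ̄} = -B_{k,ψ̄}/2k + ∑ σ_{k-1}^{𝟙,ψ̄}(n) qⁿ` of Billerey–Menares (7.1.3)/(7.1.13)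
(uses `W(ψ)W(ψ̄) = ψ(-1) N`). [cite: BillereyMenares2018, §1.3 (7.1.13)] -/
theorem eisenstein_normalising_const (hψ : ψ.IsPrimitive) {k : ℕ} (hk : 2 ≤ k)
    (hpar : ψ (-1) = (-1) ^ k) :
    2 * (((N : ℂ) ^ k)⁻¹ * ((-2 * Real.pi * I) ^ k / (k - 1).factorial) *
        gaussSum ψ (ZMod.stdAddChar (N := N))) / ψ.LFunction k =
      -(4 * k) / generalizedBernoulli k ψ⁻¹ := by
  have hWW := gaussSum_mul_gaussSum_inv ψ hψ
  rw [hpar] at hWW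
  have hB := generalizedBernoulli_inv_ne_zero ψ hψ hk hpar
  have hW := gaussSum_ne_zero ψ⁻¹ (isPrimitive_inv ψ hψ)
  have hL0 := LFunction_natCast_ne_zero ψ hk
  have hN : (N : ℂ) ≠ 0 := by exact_mod_cast NeZero.ne N
  have hk0 : (k : ℂ) ≠ 0 := by exact_mod_cast (show k ≠ 0 by omega)
  have hf : ((k - 1).factorial : ℂ) ≠ 0 := by exact_mod_cast Nat.factorial_ne_zero (k - 1)
  have hfact : (k.factorial : ℂ) = k * ((k - 1).factorial : ℂ) := by
    exact_mod_cast (Nat.mul_factorial_pred (show k ≠ 0 by omega)).symm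
  have hπ : (2 * Real.pi * I : ℂ) ^ k ≠ 0 :=
    pow_ne_zero _ (mul_ne_zero (mul_ne_zero two_ne_zero (by exact_mod_cast Real.pi_ne_zero))
      I_ne_zero)
  have hneg : (-2 * Real.pi * I : ℂ) ^ k = (-1) ^ k * (2 * Real.pi * I) ^ k := by
    rw [← mul_pow]
    ring
  have h11 : ((-1 : ℂ) ^ k) * (-1 : ℂ) ^ k = 1 := by
    rw [← pow_add, ← two_mul, pow_mul, neg_one_sq, one_pow]
  have hX : (-2 * Real.pi * I : ℂ) ^ k ≠ 0 := by
    rw [hneg]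
    exact mul_ne_zero (pow_ne_zero _ (by norm_num)) hπ
  have hCW : (-2 * Real.pi * I : ℂ) ^ k * gaussSum ψ (ZMod.stdAddChar (N := N)) *
      gaussSum ψ⁻¹ (ZMod.stdAddChar (N := N)) = (2 * Real.pi * I) ^ k * N := by
    rw [hneg, mul_assoc, hWW]
    linear_combination ((2 * Real.pi * I : ℂ) ^ k * N) * h11
  have hWeq : gaussSum ψ (ZMod.stdAddChar (N := N)) =
      (2 * Real.pi * I) ^ k * N / ((-2 * Real.pi * I) ^ k * gaussSum ψ⁻¹ (ZMod.stdAddChar (N := N))) := by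
    rw [eq_div_iff (mul_ne_zero hX hW)]
    linear_combination hCW
  have hNk : (N : ℂ) ^ k = N * (N : ℂ) ^ (k - 1) := by
    conv_lhs => rw [show k = (k - 1) + 1 by omega, pow_succ']
  rw [div_eq_div_iff hL0 hB, hWeq, LFunction_eq_bernoulli ψ hψ hk hpar, hfact, hNk]
  field_simp
  ring

end Literature.NumberTheory.LFunctions
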